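import Mathlib
import HarnessLib
import Literature.AlgebraicGeometry.Resolution.AugmentationIdeal
import Literature.AlgebraicGeometry.Resolution.RegularSequenceSpread
import Literature.AlgebraicGeometry.Resolution.ProjectiveSpaceRegular
import Summits.ResolutionOfSingularities.ResolutionOfSingularities.Theorems.WildQuotientsWildQuotientResolutionTameFixedLocus

/-!
# Tame fixed loci on regular rings are regular — the global (affine) form, in every dimension
# (crux `WildQuotients.WildQuotientResolution`, stub `stub_phaseZeroHighDim`: regular tame carrier centres)

Crux stmt-ResolutionOfSingularities-15640 (`WildQuotientResolution`), registered stub `stub_phaseZeroHighDim`.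
Companion of ✓`TameFixedLocus` (`Theorems/…TameFixedLocus.lean`: at a point of the fixed locus, the fixed-locus
ideal `⨆ g, I_{τ g}` of a finite group of invertible order acting on a regular LOCAL ring is generated by a
part of a regular system of parameters). Here the statement is globalised to an affine regular scheme, as
✓`InvolutionExit.isRegularRing_quotient_augIdeal` (`…InvolutionFixedLocusRegularGlobal.lean`) does for
involutions: for a REGULAR RING `R` (Noetherian, all localisations regular) and an action
`τ : I →* (R ≃+* R)` of a finite group whose order is a unit of `R`, the fixed-locus ring
`R ⧸ ⨆ g, I_{τ g}` — the coordinate ring of the fixed-point subscheme `(Spec R)^I` — is a regular ring. No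
residue-triviality hypothesis is needed globally: a maximal ideal `P ⊇ ⨆ g, I_{τ g}` is automatically
`τ`-stable (`τ g x = x + (τ g x − x)`), so the action localises to an action `τ_P` on `R_P` fixing the
closed point (`IsLocalization.ringEquivOfRingEquiv`, assembled into a homomorphism inside the proof), with
`(⨆ g, I_{τ g}) R_P = ⨆ g, I_{τ_P g}` (Literature `map_augIdeal_of_isLocalization`, `Ideal.map_iSup`), and
regularity of a quotient is local at the maximal ideals (Literature `isRegularRing_quotient_of_localization_maximal`).
This is the permissibility of the TAME CARRIER CENTRES `Fix(H) ⊆ X′` (`H ≤ G` of order prime to `p`) of the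
Phase-0 designs on every `G`-stable affine open of the regular `X′`, in every dimension.

[OURS · crux stmt-ResolutionOfSingularities-15640 · helper toward `stub_phaseZeroHighDim` (NOT a proof of the
stub); classical (Fogarty 1973 / Iversen 1972; smooth relative forms: Edixhoven 1992 Prop. 3.4,
Conrad–Gabber–Prasad A.8.10 (2), both ✓`…GroupActions.…_holds`), counted 0; AI-level work, weaker than
expert review.] [folklore]

* `apply_mem_iff_of_iSup_le`, `map_primeCompl_eq` — ideals containing the fixed-locus ideal are `τ`-stable;
* `isRegularRing_quotient_iSup_augIdeal` — the theorem; `isRegularRing_quotient_iSup_augIdeal_of_coprime` —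
  the form for a group of order prime to a prime `p` with `p = 0` in `R` (schemes over a field of
  characteristic `p`).
* `isRegular_Spec_quotient_iSup_augIdeal`, `isRegular_Spec_quotient_iSup_augIdeal_of_coprime` (appended) —
  the SCHEME form: the fixed-point subscheme `Spec (R ⧸ ⨆ g, I_{τ g})` of `Spec R` is a regular scheme
  (`Scheme.IsRegular`, Literature `Scheme.isRegular_Spec`).
-/

-- single-problem summit: the doubled namespace component `ResolutionOfSingularities` is forced
set_option linter.dupNamespace false

noncomputable section

namespace Summit.ResolutionOfSingularities.ResolutionOfSingularities.Theorems.WildQuotientResolution.TameFixedLocus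

open IsLocalRing
open Literature.AlgebraicGeometry.Resolution

universe u

variable {R : Type u} [CommRing R] {I : Type*} [Group I] (τ : I →* (R ≃+* R))

/-- An ideal containing the fixed-locus ideal `⨆ g, I_{τ g}` is `τ`-stable: `τ g x ∈ P ↔ x ∈ P`.
[folklore] -/
theorem apply_mem_iff_of_iSup_le {P : Ideal R} (hP : (⨆ g, augIdeal (τ g)) ≤ P) (g : I) (x : R) :
    τ g x ∈ P ↔ x ∈ P := by
  have h1 : τ g x - x ∈ P := hP (Submodule.mem_iSup_of_mem g (sub_mem_augIdeal (τ g) x))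
  constructor
  · intro h
    have e : x = τ g x - (τ g x - x) := by ring
    rw [e]
    exact sub_mem h h1
  · intro h
    have e : τ g x = x + (τ g x - x) := by ring
    rw [e]
    exact add_mem h h1

/-- The complement of a prime containing the fixed-locus ideal is mapped onto itself by every `τ g`
(the localisation hypothesis of `IsLocalization.ringEquivOfRingEquiv`). [folklore] -/
theorem map_primeCompl_eq {P : Ideal R} [P.IsPrime] (hP : (⨆ g, augIdeal (τ g)) ≤ P) (g : I) :
    P.primeCompl.map (τ g).toMonoidHom = P.primeCompl := by
  ext x
  simp only [Submonoid.mem_map, Ideal.mem_primeCompl_iff]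
  constructor
  · rintro ⟨y, hy, rfl⟩
    exact fun h => hy ((apply_mem_iff_of_iSup_le τ hP g y).mp h)
  · intro hx
    refine ⟨τ g⁻¹ x, fun h => hx ((apply_mem_iff_of_iSup_le τ hP g⁻¹ x).mp h), ?_⟩
    change τ g (τ g⁻¹ x) = x
    rw [← RingAut.mul_apply, ← map_mul, mul_inv_cancel, map_one, RingAut.one_apply]

/-- **The fixed-locus ring of a finite group of invertible order on a regular ring is regular**: for a
regular ring `R`, a finite group `I` with `|I| ∈ R×` and `τ : I →* (R ≃+* R)`, the ring
`R ⧸ ⨆ g, I_{τ g}` (coordinate ring of the fixed-point subscheme of `Spec R`) is a regular ring. Local at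
the maximal ideals over the fixed locus by ✓`isRegularLocalRing_quotient_iSup_augIdeal`. [folklore] -/
theorem isRegularRing_quotient_iSup_augIdeal [IsRegularRing R] [Finite I]
    (hI : IsUnit ((Nat.card I : ℕ) : R)) :
    IsRegularRing (R ⧸ ⨆ g, augIdeal (τ g)) := by
  refine isRegularRing_quotient_of_localization_maximal _ fun P hP hIP => ?_
  set L := Localization.AtPrime P with hL
  have H : ∀ g, P.primeCompl.map (τ g).toMonoidHom = P.primeCompl := fun g =>
    map_primeCompl_eq τ hIP g
  -- the localised automorphisms and their compatibility with `algebraMap R L`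
  let σ : I → (L ≃+* L) := fun g => IsLocalization.ringEquivOfRingEquiv L L (τ g) (H g)
  have hσalg : ∀ (g : I) (b : R), σ g (algebraMap R L b) = algebraMap R L (τ g b) := fun g b =>
    IsLocalization.ringEquivOfRingEquiv_eq (H g) b
  have hσ_mul : ∀ g h : I, σ (g * h) = σ g * σ h := by
    intro g h
    apply RingEquiv.ext
    intro z
    have hcomp : ((σ (g * h) : L ≃+* L) : L →+* L) = (σ g : L →+* L).comp (σ h : L →+* L) := by
      refine IsLocalization.ringHom_ext P.primeCompl ?_
      ext b
      simp only [RingHom.comp_apply, RingHom.coe_coe]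
      rw [hσalg, hσalg, hσalg, map_mul, RingAut.mul_apply]
    exact DFunLike.congr_fun hcomp z
  have hσ_one : σ 1 = 1 := by
    apply RingEquiv.ext
    intro z
    have hcomp : ((σ 1 : L ≃+* L) : L →+* L) = RingHom.id L := by
      refine IsLocalization.ringHom_ext P.primeCompl ?_
      ext b
      simp only [RingHom.comp_apply, RingHom.coe_coe, RingHom.id_apply]
      rw [hσalg, map_one, RingAut.one_apply]
    exact DFunLike.congr_fun hcomp z
  -- the localised action
  let τP : I →* (L ≃+* L) := { toFun := σ, map_one' := hσ_one, map_mul' := hσ_mul }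
  have hτPalg : ∀ (g : I) (b : R), τP g (algebraMap R L b) = algebraMap R L (τ g b) := hσalg
  have hIL : IsUnit ((Nat.card I : ℕ) : L) := by
    have h := hI.map (algebraMap R L)
    rwa [map_natCast] at h
  have haug : (⨆ g, augIdeal (τ g)).map (algebraMap R L) = ⨆ g, augIdeal (τP g) := by
    rw [Ideal.map_iSup]
    exact iSup_congr fun g => map_augIdeal_of_isLocalization P.primeCompl (τ g) (τP g) (hτPalg g)
  have hle : (⨆ g, augIdeal (τP g)) ≤ maximalIdeal L := by
    rw [← haug, ← Localization.AtPrime.map_eq_maximalIdeal]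
    exact Ideal.map_mono hIP
  have hreg : IsRegularLocalRing (L ⧸ ⨆ g, augIdeal (τP g)) :=
    isRegularLocalRing_quotient_iSup_augIdeal τP hIL hle
  refine ⟨L, inferInstance, inferInstance, inferInstance, ?_⟩
  rw [haug]
  exact hreg

/-- **Residue-characteristic form**: if a prime `p` is zero in the regular ring `R` (e.g. `R` of finite
type over a field of characteristic `p`) and the finite group `I` has order prime to `p`, the fixed-locus
ring `R ⧸ ⨆ g, I_{τ g}` is regular — tame subgroups of `G` have regular fixed loci on every affine open of
the regular `X′`, in every dimension. [folklore] -/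
theorem isRegularRing_quotient_iSup_augIdeal_of_coprime [IsRegularRing R] [Finite I] (p : ℕ)
    [Fact p.Prime] [CharP R p] (hcop : (Nat.card I).Coprime p) :
    IsRegularRing (R ⧸ ⨆ g, augIdeal (τ g)) := by
  have hp : p.Prime := Fact.out
  refine isRegularRing_quotient_iSup_augIdeal τ ?_
  -- `|I|` is a unit modulo `p`, hence in the `𝔽_p`-algebra `R`
  have hu : IsUnit ((Nat.card I : ℕ) : ZMod p) := by
    rw [ZMod.isUnit_iff_coprime]
    exact hcop
  have h := hu.map (ZMod.castHom (dvd_refl p) R)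
  rwa [map_natCast] at h

/-! ## Scheme form: the fixed-point subscheme of `Spec R` is a regular scheme -/

open AlgebraicGeometry in
/-- **Scheme form**: for a regular ring `R` and a finite group of invertible order acting by
`τ : I →* (R ≃+* R)`, the fixed-point subscheme `Spec (R ⧸ ⨆ g, I_{τ g})` of `Spec R` is a REGULAR SCHEME
(`Scheme.IsRegular`: all stalks regular local rings) — the affine-local statement that the tame carrier
centres `Fix(H)` of Phase 0 are regular closed subschemes of the regular `X′`, in every dimension.
[folklore] -/
theorem isRegular_Spec_quotient_iSup_augIdeal [IsRegularRing R] [Finite I]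
    (hI : IsUnit ((Nat.card I : ℕ) : R)) :
    Scheme.IsRegular (Spec (.of (R ⧸ ⨆ g, augIdeal (τ g)))) := by
  haveI : IsRegularRing (R ⧸ ⨆ g, augIdeal (τ g)) := isRegularRing_quotient_iSup_augIdeal τ hI
  exact Scheme.isRegular_Spec (.of (R ⧸ ⨆ g, augIdeal (τ g)))

open AlgebraicGeometry in
/-- **Scheme form, residue-characteristic version**: `p` prime with `p = 0` in the regular ring `R`,
`|I|` prime to `p` ⇒ the fixed-point subscheme `Spec (R ⧸ ⨆ g, I_{τ g})` is a regular scheme. [folklore] -/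
theorem isRegular_Spec_quotient_iSup_augIdeal_of_coprime [IsRegularRing R] [Finite I] (p : ℕ)
    [Fact p.Prime] [CharP R p] (hcop : (Nat.card I).Coprime p) :
    Scheme.IsRegular (Spec (.of (R ⧸ ⨆ g, augIdeal (τ g)))) := by
  haveI : IsRegularRing (R ⧸ ⨆ g, augIdeal (τ g)) :=
    isRegularRing_quotient_iSup_augIdeal_of_coprime τ p hcop
  exact Scheme.isRegular_Spec (.of (R ⧸ ⨆ g, augIdeal (τ g)))

end Summit.ResolutionOfSingularities.ResolutionOfSingularities.Theorems.WildQuotientResolution.TameFixedLocus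

end
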